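import Summits.Ventures.Crystal3D.Theorems.StickyWulffConstantCoaxialWallLawUnifAtOfRowsWith
import Summits.Ventures.Crystal3D.Theorems.StickyWulffConstantCoaxialWallLawOnSiteBridgeCxTwoSqrtSix
import HarnessLib

/-!
# F-U CAPSTONES OF RECORD: `∃ C, CoaxialTwoSlabAdhesionUnifAt C 10` from `P5Exhaustion`, the on-site fact over 𝒰_cx and the tails

HONEST FRAMING. Venture `Summits/Ventures/Crystal3D` (cell `crystal3d-full`), helper `--supports` the crux
`CoaxialWallLaw` (stmt-Ventures-19481, REGISTERED line `WallLedgerF`) and lane T's stub `stub_coaxialUnif :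
∃ C, CoaxialUnifAt C 10` (TexShadow v6.20; `CoaxialUnifAt` unfolds to `CoaxialTwoSlabAdhesionUnifAt`, 19481-p2
`…UnifFromDefs`).  Rung credit; F-C1 not moved; CONDITIONAL on named facts; grade COMPUTATIONAL (through
`…TwoRowsCertifiedA` / `…OnSiteBridgeCx`: certified `kissingGap_250`, `kissingClassification_250`,
`StarFar.starPairFar_holds`).  cf-p1 DECISIONS (lxii) (𝒰_cx = coaxial module windows), (lxvii) (F-U at `R₀ := 10`),
(lxxi) (lane F's closing theorem of record = `coaxialWallLaw_of_onSiteFlatA_v2A_nineHalves_cx`), (lxxiv)(2) (tail line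
`s_F := 2√6`).  This file gives the SAME hypotheses ⇒ the UNIFORM law, and the closing chain at the tail line of record:

* `coaxialTwoSlabAdhesionUnifAt_of_twoRowsA_certified` — any version, `0 < s_F ≤ 2√6`, the two (A) rows;
* `coaxialTwoSlabAdhesionUnifAt_of_onSiteFlatA_cx_certified` — any version, `0 < s_F ≤ 2√6`:
  `P5Exhaustion → EndRowOnSiteFlatA ver s_F coaxialModuleUniverse → EndRowTwinTailA … → EndRowTransTailA … →
  ∃ C, CoaxialTwoSlabAdhesionUnifAt C 10`;
* **`coaxialTwoSlabAdhesionUnifAt_of_onSiteFlatA_v2A_nineHalves_cx`** — THE F-U CAPSTONE at the key of record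
  `(v2(A), s_F = 9/2, 𝒰_cx)`: exactly the hypotheses of `coaxialWallLaw_of_onSiteFlatA_v2A_nineHalves_cx`;
* **the TAIL LINE OF RECORD `s_F = 2√6`** (cf-p1 DECISION (lxxiv)(2); 19481-p2's `…OnSiteBridgeCxTwoSqrtSix`:
  `endRowOnSiteFlatA_mono_const`, `coaxialWallLaw_of_onSiteFlatA_v2A_twoSqrtSix_cx`): the F-U twin
  `coaxialTwoSlabAdhesionUnifAt_of_onSiteFlatA_nineHalves_tails_twoSqrtSix_cx : P5Exhaustion → EndRowOnSiteFlatA v2 (9/2) 𝒰_cx →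
  EndRowTwinTailA v2 (2√6) 𝒰_cx → EndRowTransTailA v2 (2√6) 𝒰_cx → ∃ C, CoaxialTwoSlabAdhesionUnifAt C 10`;
* `coaxialWallLaw_and_unifAt_of_onSiteFlatA_v2A_{nineHalves,twoSqrtSix}_cx` — the crux and its uniform form together.
LANE F's BY-NAME DEBTS after this file: {`P5Exhaustion` (E1), `EndRowOnSiteFlatA v2 (9/2) coaxialModuleUniverse`
(certificate, lit bnb-ucx), the two off-module tails AT `2√6` (19481-p2, F-TAIL §6 T1–T4)} — for BOTH the crux and F-U.
WHAT THIS IS NOT: none of the hypotheses is proved here; F-C1 not moved.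
-/

noncomputable section

namespace Summit.Ventures.Crystal3D.Theorems

open Summit.Ventures.Crystal3D

/-- **F-U from `P5Exhaustion` and the two (A) census rows**, any version, `0 < s_F ≤ 2√6`, kissing facts and `StarPairFar`
certified. -/
theorem coaxialTwoSlabAdhesionUnifAt_of_twoRowsA_certified (ver : WordVersion) (hE1 : P5Exhaustion) {sF : ℝ}
    (hsF : 0 < sF) (hsF' : sF ≤ 2 * Real.sqrt 6) (hrowW : EndRowTwinHalfTurnA ver sF) (hrowT : EndRowTransA ver sF) :
    ∃ C : ℝ, CoaxialTwoSlabAdhesionUnifAt C 10 :=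
  coaxialTwoSlabAdhesionUnifAt_ten_of_twoRowsA_p5 ver kissingGap_250 kissingClassification_250 hsF hsF' hrowW hrowT hE1
    StarFar.starPairFar_holds

/-- **F-U from `P5Exhaustion`, the on-site fact over 𝒰_cx and the two off-module tails**, any version,
`0 < s_F ≤ 2√6`. -/
theorem coaxialTwoSlabAdhesionUnifAt_of_onSiteFlatA_cx_certified (ver : WordVersion) (hE1 : P5Exhaustion) {sF : ℝ}
    (hsF : 0 < sF) (hsF' : sF ≤ 2 * Real.sqrt 6) (hon : EndRowOnSiteFlatA ver sF coaxialModuleUniverse)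
    (htailW : EndRowTwinTailA ver sF coaxialModuleUniverse) (htailT : EndRowTransTailA ver sF coaxialModuleUniverse) :
    ∃ C : ℝ, CoaxialTwoSlabAdhesionUnifAt C 10 :=
  coaxialTwoSlabAdhesionUnifAt_of_twoRowsA_certified ver hE1 hsF hsF' (endRowTwinHalfTurnA_of_onSiteFlatA_cx hon htailW)
    (endRowTransA_of_onSiteFlatA_cx hon htailT)

/-- **THE F-U CAPSTONE AT THE KEY OF RECORD `(v2(A), s_F = 9/2, 𝒰_cx)`** — the hypotheses of lane F's closing theorem
`coaxialWallLaw_of_onSiteFlatA_v2A_nineHalves_cx` verbatim give the UNIFORM law `∃ C, CoaxialTwoSlabAdhesionUnifAt C 10`. -/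
theorem coaxialTwoSlabAdhesionUnifAt_of_onSiteFlatA_v2A_nineHalves_cx (hE1 : P5Exhaustion)
    (hon : EndRowOnSiteFlatA WordVersion.v2 (9 / 2) coaxialModuleUniverse)
    (htailW : EndRowTwinTailA WordVersion.v2 (9 / 2) coaxialModuleUniverse)
    (htailT : EndRowTransTailA WordVersion.v2 (9 / 2) coaxialModuleUniverse) :
    ∃ C : ℝ, CoaxialTwoSlabAdhesionUnifAt C 10 :=
  coaxialTwoSlabAdhesionUnifAt_of_onSiteFlatA_cx_certified WordVersion.v2 hE1 (by norm_num) nine_halves_le_two_sqrt_six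
    hon htailW htailT

/-- **F-U AT THE TAIL LINE OF RECORD `2√6`**: the same three hypotheses give `∃ C, CoaxialTwoSlabAdhesionUnifAt C 10`. -/
theorem coaxialTwoSlabAdhesionUnifAt_of_onSiteFlatA_nineHalves_tails_twoSqrtSix_cx (hE1 : P5Exhaustion)
    (hon : EndRowOnSiteFlatA WordVersion.v2 (9 / 2) coaxialModuleUniverse)
    (htailW : EndRowTwinTailA WordVersion.v2 (2 * Real.sqrt 6) coaxialModuleUniverse)
    (htailT : EndRowTransTailA WordVersion.v2 (2 * Real.sqrt 6) coaxialModuleUniverse) :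
    ∃ C : ℝ, CoaxialTwoSlabAdhesionUnifAt C 10 :=
  coaxialTwoSlabAdhesionUnifAt_of_onSiteFlatA_cx_certified WordVersion.v2 hE1 two_sqrt_six_pos le_rfl
    (endRowOnSiteFlatA_mono_const nine_halves_le_two_sqrt_six hon) htailW htailT

/-- The crux AND its uniform form from the same three hypotheses AT THE TAIL LINE OF RECORD (for the record). -/
theorem coaxialWallLaw_and_unifAt_of_onSiteFlatA_v2A_twoSqrtSix_cx (hE1 : P5Exhaustion)
    (hon : EndRowOnSiteFlatA WordVersion.v2 (9 / 2) coaxialModuleUniverse)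
    (htailW : EndRowTwinTailA WordVersion.v2 (2 * Real.sqrt 6) coaxialModuleUniverse)
    (htailT : EndRowTransTailA WordVersion.v2 (2 * Real.sqrt 6) coaxialModuleUniverse) :
    Summit.Ventures.Crystal3D.Theses.StickyWulffConstant.CoaxialWallLaw ∧ ∃ C : ℝ, CoaxialTwoSlabAdhesionUnifAt C 10 :=
  ⟨coaxialWallLaw_of_onSiteFlatA_v2A_twoSqrtSix_cx hE1 hon htailW htailT,
    coaxialTwoSlabAdhesionUnifAt_of_onSiteFlatA_nineHalves_tails_twoSqrtSix_cx hE1 hon htailW htailT⟩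

/-- The crux AND its uniform form from the same three hypotheses (for the record). -/
theorem coaxialWallLaw_and_unifAt_of_onSiteFlatA_v2A_nineHalves_cx (hE1 : P5Exhaustion)
    (hon : EndRowOnSiteFlatA WordVersion.v2 (9 / 2) coaxialModuleUniverse)
    (htailW : EndRowTwinTailA WordVersion.v2 (9 / 2) coaxialModuleUniverse)
    (htailT : EndRowTransTailA WordVersion.v2 (9 / 2) coaxialModuleUniverse) :
    Summit.Ventures.Crystal3D.Theses.StickyWulffConstant.CoaxialWallLaw ∧ ∃ C : ℝ, CoaxialTwoSlabAdhesionUnifAt C 10 :=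
  ⟨coaxialWallLaw_of_onSiteFlatA_v2A_nineHalves_cx hE1 hon htailW htailT,
    coaxialTwoSlabAdhesionUnifAt_of_onSiteFlatA_v2A_nineHalves_cx hE1 hon htailW htailT⟩

end Summit.Ventures.Crystal3D.Theorems

end
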